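import Literature.AlgebraicGeometry.AbelianSchemes.AbelianSchemeOverBase
import HarnessLib

/-!
# Ring actions `ι : 𝒪 → End_S(A)` on an abelian scheme over a base, by homomorphisms (instance-free carrier)

Topic `AlgebraicGeometry/AbelianSchemes`, namespace `Literature.AlgebraicGeometry.AbelianSchemes.AbelianSchemeOver` (ONE structure
with data + proved bookkeeping lemmas; no named fact, no `sorry`, no `instance` declaration, no notation).  Cell `hodgecm-mathlib`,
programme F0/P6 «MOD»: the CARRIER of print's «`ι : O_F → End(A)` a ring homomorphism» ([RSZ2020] §3.2; [Kottwitz1992] §5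
«`i : O_B → End(A)`»; [Liu2021] Def. C.10 (1)) for an abelian scheme `A → S` over an ARBITRARY base scheme `S` (the tree's ★
`AbelianScheme.RingAction` of `AbelianSchemeRingActionLie.lean` is the same notion over an AFFINE base `Spec R`; this is its
`AbelianSchemeOver` twin, field-for-field the P6 day-1 kit `RSZTuple.desk` §1).  Consumers: the CM triple ∕ RSZ tuple carriers
(`RSZ2020/CMTriple`), the Serre tensor construction `A ⊗_𝒪 𝔟` (`SerreTensorConstruction`), the Kottwitz condition.  The ROSATI
clause «the Rosati involution of `λ` induces `c` on `𝒪`» is NOT typed here (it needs dual pairs and polarisations; it lives with the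
CM-triple carrier).  `--supports stmt-HodgeConjecture-24832`, count-neutral.  HC_CM is proved only modulo the 2 remaining named inputs
(hLiu418, h413) until rung 0 closes; this file discharges none of them.

## The structure (written WITHOUT a `Ring` instance on `End_S(A)`)

`RingAction O A`: `i : O → (A.X ⟶ A.X)` (print's `ι(a)`), each `i a` a homomorphism of `S`-group schemes (Mathlib `IsMonHom`),
`i 1 = 𝟙`, `i (a * b) = i b ≫ i a` (so that `(ab)·x = a·(b·x)`), `i 0 = 1` and `i (a + b) = i a * i b` in the group `Hom_S(A, A)` of
`A`-valued points of `A` (Mathlib's scoped `Hom.group`; multiplication is composition, addition is the group law).  Bookkeeping: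
`isMonHom_i` (by name), `i_neg`, `i_sub`, `i_natCast`-free `i_nsmul`/`i_mul_comm`, the monoid homomorphism `iMonoidHom : Multiplicative O →* …`
is not introduced (no new algebraic instances); `comp_i_mul : f ≫ i (a * b) = (f ≫ i b) ≫ i a` for points.

## References
* [RSZ2020] M. Rapoport, B. Smithling, W. Zhang, *Arithmetic diagonal cycles on unitary Shimura varieties*, Compos. Math. 156
  (2020), §3.2 (the moduli problem: «`ι₀ : O_F → End(A₀)`», «`ι : O_F ⊗ ℤ_{(p)} → End(A) ⊗ ℤ_{(p)}`»).
* [Kottwitz1992] R. E. Kottwitz, *Points on some Shimura varieties over finite fields*, J. Amer. Math. Soc. 5 (1992), §5 (p. 390).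
* [Liu2021] Y. Liu, *Fourier–Jacobi cycles and arithmetic relative trace formula*, Camb. J. Math. 9 (2021), Def. C.10 (1).
* Tree: `AbelianSchemes/AbelianSchemeOverBase` (the carrier `AbelianSchemeOver S`), `AbelianSchemes/AbelianSchemeRingActionLie`
  (affine-base twin `AbelianScheme.RingAction`).
-/

noncomputable section

universe u

open CategoryTheory CategoryTheory.Limits AlgebraicGeometry MonoidalCategory CartesianMonoidalCategory
open scoped MonObj

namespace Literature.AlgebraicGeometry.AbelianSchemes

namespace AbelianSchemeOver

variable {S : Scheme.{u}}

/-- An ACTION of a commutative ring `O` on an abelian scheme `A → S` by homomorphisms of `S`-group schemes — print's «`ι : O →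
End(A)` a ring homomorphism», spelled WITHOUT a `Ring` structure on `End_S(A)`: multiplication is composition (`i (a * b) = i b ≫ i a`),
addition is the group law of `Hom_S(A, A)` (`i (a + b) = i a * i b`, `i 0 = 1`).
[cite: Kottwitz1992, §5 (p. 390)] [cite: Liu2021, Definition C.10 (1)] -/
structure RingAction (O : Type*) [CommRing O] (A : AbelianSchemeOver S) where
  /-- `i a : A → A` over `S` (print's `ι(a)`). -/
  i : O → (A.X ⟶ A.X)
  /-- each `i a` is a homomorphism of `S`-group schemes -/
  isMonHom : ∀ a, IsMonHom (i a)
  /-- `ι 1 = id` -/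
  i_one : i 1 = 𝟙 A.X
  /-- `ι (ab) = ι a ∘ ι b` (diagrammatic order `ι b ≫ ι a`) -/
  i_mul : ∀ a b, i (a * b) = i b ≫ i a
  /-- `ι 0` is the unit of the group `Hom_S(A, A)` (the zero endomorphism) -/
  i_zero : i 0 = 1
  /-- `ι (a + b) = ι a · ι b` in the group `Hom_S(A, A)` -/
  i_add : ∀ a b, i (a + b) = i a * i b

namespace RingAction

variable {O : Type*} [CommRing O] {A : AbelianSchemeOver S} (act : RingAction O A)

/-- `ι a` is a homomorphism (the field, by name, usable as `haveI`). [cite: Kottwitz1992, §5 (p. 390)] -/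
theorem isMonHom_i (a : O) : IsMonHom (act.i a) := act.isMonHom a

/-- `ι (-a) = (ι a)⁻¹` in the group `Hom_S(A, A)`. [cite: Kottwitz1992, §5 (p. 390)] -/
theorem i_neg (a : O) : act.i (-a) = (act.i a)⁻¹ := by
  have h : act.i (-a) * act.i a = 1 := by rw [← act.i_add, neg_add_cancel, act.i_zero]
  exact eq_inv_of_mul_eq_one_left h

/-- `ι (a - b) = ι a · (ι b)⁻¹`. [cite: Kottwitz1992, §5 (p. 390)] -/
theorem i_sub (a b : O) : act.i (a - b) = act.i a * (act.i b)⁻¹ := by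
  rw [sub_eq_add_neg, act.i_add, act.i_neg]

/-- `ι (n • a) = (ι a) ^ n`. [cite: Kottwitz1992, §5 (p. 390)] -/
theorem i_nsmul (n : ℕ) (a : O) : act.i (n • a) = act.i a ^ n := by
  induction n with
  | zero => rw [zero_smul, act.i_zero, _root_.pow_zero]
  | succ n ih => rw [succ_nsmul, act.i_add, ih, _root_.pow_succ]

/-- `ι a` and `ι b` commute (the ring `O` is commutative). [cite: Kottwitz1992, §5 (p. 390)] -/
theorem i_comm (a b : O) : act.i a ≫ act.i b = act.i b ≫ act.i a := by
  rw [← act.i_mul, ← act.i_mul, mul_comm]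

/-- On points: `f ≫ ι (ab) = (f ≫ ι b) ≫ ι a`. [cite: Kottwitz1992, §5 (p. 390)] -/
@[reassoc]
theorem comp_i_mul {T : Over S} (f : T ⟶ A.X) (a b : O) : f ≫ act.i (a * b) = (f ≫ act.i b) ≫ act.i a := by
  rw [act.i_mul, Category.assoc]

/-- On points: `f ≫ ι (a + b) = (f ≫ ι a) * (f ≫ ι b)`. [cite: Kottwitz1992, §5 (p. 390)] -/
theorem comp_i_add {T : Over S} (f : T ⟶ A.X) (a b : O) : f ≫ act.i (a + b) = (f ≫ act.i a) * (f ≫ act.i b) := by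
  rw [act.i_add, MonObj.comp_mul]

/-- On points: `(f * g) ≫ ι a = (f ≫ ι a) * (g ≫ ι a)` (`ι a` is a homomorphism). [cite: Kottwitz1992, §5 (p. 390)] -/
theorem mul_comp_i {T : Over S} (f g : T ⟶ A.X) (a : O) : (f * g) ≫ act.i a = (f ≫ act.i a) * (g ≫ act.i a) := by
  haveI := act.isMonHom a
  rw [MonObj.mul_comp]

/-- On points: `f ≫ ι 0 = 1` and `f ≫ ι 1 = f`. [cite: Kottwitz1992, §5 (p. 390)] -/
theorem comp_i_zero_one {T : Over S} (f : T ⟶ A.X) : f ≫ act.i 0 = 1 ∧ f ≫ act.i 1 = f := by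
  rw [act.i_zero, MonObj.comp_one, act.i_one, Category.comp_id]
  exact ⟨rfl, rfl⟩

end RingAction

end AbelianSchemeOver

end Literature.AlgebraicGeometry.AbelianSchemes

end
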